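import Literature.NumberTheory.LFunctions.WeilTwoPrimeCells
import HarnessLib

/-!
# RiemannHypothesis / GroundBarta machinery — LATTICE RIPPLES, Taylor-sum cells (1/2): one ripple, wide Maclaurin remainders,
interval coefficients

Helper file (`--supports stmt-RiemannHypothesis-18085`; infrastructure for the phantom-ripple moment certificates, memo
`run/shared/lean/pub/rh-explicit/rh-explicit-weil-1/FORMAT-PHANTOM.md`), RH-free, axioms standard.  Seat rh-explicit-weil-1.

A lattice ripple `A cos(t x)`, `x = j log 2 + k log 3`, is expanded on a cell `[u, u + w]` as
`A cos(x(u+h)) = Σ_{i<n} (α Re(I^i) + β Im(I^i)) x^i h^i / i! + E`,  `α = A cos(ux)`, `β = −A sin(ux)`,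
`|E| ≤ 2(|α| + |β|)(xh)^n/n!` for `xh ≤ (n+1)/2` (WIDE Maclaurin remainder from `Complex.exp_bound'`, no sign condition on
`cos(xh)`, `sin(xh)` — so cells may be as wide as the digamma cells).  The real numbers `α, β, x` are enclosed by the fixed-point
engine (`FI`) through TWO-SIDED claims `alo ≤ α ≤ ahi`, `blo ≤ β ≤ bhi`, `xlo ≤ x ≤ xhi`, and each Taylor coefficient gets a
rational interval `[termLo, termHi]` (`XRip.term_mem`).  File 2/2 (`…LatticeRippleCells.lean`) sums the ripples of a cell into
ONE polynomial with a certified slack `ε`, so that the moment layer sees one low-degree polynomial per cell.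
Everything here is proved; no named facts.
-/

set_option linter.dupNamespace false

noncomputable section

open Complex Finset MeasureTheory Set Filter
open scoped Real Topology BigOperators

namespace Summit.RiemannHypothesis.RiemannHypothesis.Theorems.EvenWinsBeyondArch

open Literature.NumberTheory.LFunctions
open Literature.Analysis.ValidatedNumerics.Numerics
open Literature.Analysis.SpecialFunctions

/-! ## Wide Maclaurin remainders of `cos`, `sin` (`|y| ≤ (n+1)/2`) -/

/-- `|cos y − Σ_{k<n} Re(I^k) y^k/k!| ≤ 2|y|^n/n!` for `|y| ≤ (n+1)/2`. [folklore] -/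
theorem abs_cos_sub_sum_le_wide {y : ℝ} {n : ℕ} (hy : |y| / (n + 1) ≤ 1 / 2) :
    |Real.cos y - ∑ k ∈ Finset.range n, ((reIpowQ k : ℚ) : ℝ) * y ^ k / k.factorial| ≤ 2 * |y| ^ n / n.factorial := by
  have hnorm : ‖(y : ℂ) * I‖ = |y| := by
    rw [Complex.norm_mul, Complex.norm_I, mul_one, Complex.norm_real, Real.norm_eq_abs]
  have hx : ‖(y : ℂ) * I‖ / (n.succ : ℕ) ≤ 1 / 2 := by rw [hnorm]; push_cast; exact hy
  have h := Complex.exp_bound' hx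
  have hre : (Complex.exp ((y : ℂ) * I) - ∑ m ∈ Finset.range n, ((y : ℂ) * I) ^ m / m.factorial).re =
      Real.cos y - ∑ k ∈ Finset.range n, ((reIpowQ k : ℚ) : ℝ) * y ^ k / k.factorial := by
    rw [Complex.sub_re, Complex.exp_ofReal_mul_I_re, Complex.re_sum]
    congr 1
    refine Finset.sum_congr rfl fun m _ ↦ ?_
    have e : ((y : ℂ) * I) ^ m / (m.factorial : ℂ) = ((y ^ m / m.factorial : ℝ) : ℂ) * I ^ m := by
      push_cast; rw [mul_pow]; ring
    rw [e, Complex.re_ofReal_mul, re_I_pow]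
    ring
  rw [← hre]
  refine (Complex.abs_re_le_norm _).trans (h.trans (le_of_eq ?_))
  rw [hnorm]; ring

/-- `|sin y − Σ_{k<n} Im(I^k) y^k/k!| ≤ 2|y|^n/n!` for `|y| ≤ (n+1)/2`. [folklore] -/
theorem abs_sin_sub_sum_le_wide {y : ℝ} {n : ℕ} (hy : |y| / (n + 1) ≤ 1 / 2) :
    |Real.sin y - ∑ k ∈ Finset.range n, ((imIpowQ k : ℚ) : ℝ) * y ^ k / k.factorial| ≤ 2 * |y| ^ n / n.factorial := by
  have hnorm : ‖(y : ℂ) * I‖ = |y| := by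
    rw [Complex.norm_mul, Complex.norm_I, mul_one, Complex.norm_real, Real.norm_eq_abs]
  have hx : ‖(y : ℂ) * I‖ / (n.succ : ℕ) ≤ 1 / 2 := by rw [hnorm]; push_cast; exact hy
  have h := Complex.exp_bound' hx
  have him : (Complex.exp ((y : ℂ) * I) - ∑ m ∈ Finset.range n, ((y : ℂ) * I) ^ m / m.factorial).im =
      Real.sin y - ∑ k ∈ Finset.range n, ((imIpowQ k : ℚ) : ℝ) * y ^ k / k.factorial := by
    rw [Complex.sub_im, Complex.exp_ofReal_mul_I_im, Complex.im_sum]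
    congr 1
    refine Finset.sum_congr rfl fun m _ ↦ ?_
    have e : ((y : ℂ) * I) ^ m / (m.factorial : ℂ) = ((y ^ m / m.factorial : ℝ) : ℂ) * I ^ m := by
      push_cast; rw [mul_pow]; ring
    rw [e, Complex.im_ofReal_mul, im_I_pow]
    ring
  rw [← him]
  refine (Complex.abs_im_le_norm _).trans (h.trans (le_of_eq ?_))
  rw [hnorm]; ring

/-! ## Rational interval products -/

/-- Lower end of `[a,b]·[c,d]`. [folklore] -/
def mul4Lo (a b c d : ℚ) : ℚ := min (min (a * c) (a * d)) (min (b * c) (b * d))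

/-- Upper end of `[a,b]·[c,d]`. [folklore] -/
def mul4Hi (a b c d : ℚ) : ℚ := max (max (a * c) (a * d)) (max (b * c) (b * d))

/-- Soundness of the interval product. [folklore] -/
theorem mul4_mem {a b c d : ℚ} {x y : ℝ} (hax : (a : ℝ) ≤ x) (hxb : x ≤ (b : ℝ)) (hcy : (c : ℝ) ≤ y) (hyd : y ≤ (d : ℝ)) :
    ((mul4Lo a b c d : ℚ) : ℝ) ≤ x * y ∧ x * y ≤ ((mul4Hi a b c d : ℚ) : ℝ) := by
  unfold mul4Lo mul4Hi
  push_cast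
  -- `x*y` lies between the extreme corner products: first in `x` (fixed `y`), then in `y`
  have h1 : min ((a : ℝ) * y) (b * y) ≤ x * y ∧ x * y ≤ max ((a : ℝ) * y) (b * y) := by
    rcases le_or_gt 0 y with hy | hy
    · exact ⟨(min_le_left _ _).trans (mul_le_mul_of_nonneg_right hax hy),
        (mul_le_mul_of_nonneg_right hxb hy).trans (le_max_right _ _)⟩
    · exact ⟨(min_le_right _ _).trans (mul_le_mul_of_nonpos_right hxb hy.le),
        (mul_le_mul_of_nonpos_right hax hy.le).trans (le_max_left _ _)⟩
  have h2 : ∀ e : ℝ, min (e * (c : ℝ)) (e * d) ≤ e * y ∧ e * y ≤ max (e * (c : ℝ)) (e * d) := by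
    intro e
    rcases le_or_gt 0 e with he | he
    · exact ⟨(min_le_left _ _).trans (mul_le_mul_of_nonneg_left hcy he),
        (mul_le_mul_of_nonneg_left hyd he).trans (le_max_right _ _)⟩
    · exact ⟨(min_le_right _ _).trans (mul_le_mul_of_nonpos_left hyd he.le),
        (mul_le_mul_of_nonpos_left hcy he.le).trans (le_max_left _ _)⟩
  have ha := h2 (a : ℝ); have hb := h2 (b : ℝ)
  constructor
  · have : min (min ((a : ℝ) * c) (a * d)) (min ((b : ℝ) * c) (b * d)) ≤ min ((a : ℝ) * y) (b * y) :=
      le_min ((min_le_left _ _).trans ha.1) ((min_le_right _ _).trans hb.1)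
    exact this.trans h1.1
  · have : max ((a : ℝ) * y) (b * y) ≤ max (max ((a : ℝ) * c) (a * d)) (max ((b : ℝ) * c) (b * d)) :=
      max_le (ha.2.trans (le_max_left _ _)) (hb.2.trans (le_max_right _ _))
    exact h1.2.trans this

/-! ## One ripple with two-sided claims -/

/-- One lattice ripple `A cos(t x)`, `x = j log 2 + k log 3`, with TWO-SIDED cell-local claims `xlo ≤ x ≤ xhi`, `alo ≤ A cos(ux) ≤ ahi`,
`blo ≤ −A sin(ux) ≤ bhi` (verified against the engine by `XRip.check`). [folklore] -/
structure XRip where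
  /-- multiplicity of `log 2` -/
  j : ℤ
  /-- multiplicity of `log 3` -/
  k : ℤ
  /-- amplitude -/
  A : ℚ
  /-- claimed enclosure of the frequency -/
  xlo : ℚ
  /-- claimed enclosure of the frequency -/
  xhi : ℚ
  /-- claimed enclosure of `A cos(ux)` -/
  alo : ℚ
  /-- claimed enclosure of `A cos(ux)` -/
  ahi : ℚ
  /-- claimed enclosure of `−A sin(ux)` -/
  blo : ℚ
  /-- claimed enclosure of `−A sin(ux)` -/
  bhi : ℚ

namespace XRip

variable (r : XRip)

/-- The frequency `x = j log 2 + k log 3`. [folklore] -/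
def freq : ℝ := (r.j : ℝ) * Real.log 2 + (r.k : ℝ) * Real.log 3

/-- The ripple `A cos(t x)`. [folklore] -/
def val (t : ℝ) : ℝ := (r.A : ℝ) * Real.cos (t * r.freq)

/-- `α = A cos(ux)`. [folklore] -/
def alpha (u : ℚ) : ℝ := (r.A : ℝ) * Real.cos ((u : ℝ) * r.freq)

/-- `β = −A sin(ux)`. [folklore] -/
def beta (u : ℚ) : ℝ := -((r.A : ℝ) * Real.sin ((u : ℝ) * r.freq))

/-- Engine enclosure of the frequency. [folklore] -/
def freqFI : FI := FI.add (FI.mulInt logTwoFI r.j) (FI.mulInt logThreeFI r.k)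

/-- The engine encloses the lattice frequency `j log 2 + k log 3` (two-sided-claim ripple). [folklore] -/
theorem freq_mem_freqFI : FI.mem ((r.j : ℝ) * Real.log 2 + (r.k : ℝ) * Real.log 3) r.freqFI := by
  have h := FI.mem_add (FI.mem_mulInt mem_logTwoFI r.j) (FI.mem_mulInt mem_logThreeFI r.k)
  have e : Real.log 2 * (r.j : ℝ) + Real.log 3 * (r.k : ℝ) = (r.j : ℝ) * Real.log 2 + (r.k : ℝ) * Real.log 3 := by ring
  rw [e] at h
  exact h

/-- `u·x` as an interval. [folklore] -/
def thetaFI (u : ℚ) : FI := FI.mul (FI.ofRat u) r.freqFI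

/-- The engine encloses `u · (j log 2 + k log 3)` (two-sided-claim ripple). [folklore] -/
theorem theta_mem_thetaFI (u : ℚ) : FI.mem ((u : ℝ) * ((r.j : ℝ) * Real.log 2 + (r.k : ℝ) * Real.log 3)) (r.thetaFI u) :=
  FI.mem_mul (FI.mem_ofRat u) r.freq_mem_freqFI

/-- Engine interval of `α`. [folklore] -/
def alphaFI (u : ℚ) : FI := FI.mul (FI.ofRat r.A) (FI.cosSin (r.thetaFI u)).1

/-- Engine interval of `β`. [folklore] -/
def betaFI (u : ℚ) : FI := FI.neg (FI.mul (FI.ofRat r.A) (FI.cosSin (r.thetaFI u)).2)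

/-- `α ∈ alphaFI`. [folklore] -/
theorem mem_alphaFI (u : ℚ) : FI.mem (r.alpha u) (r.alphaFI u) :=
  FI.mem_mul (FI.mem_ofRat r.A) (FI.mem_cosSin (r.theta_mem_thetaFI u)).1

/-- `β ∈ betaFI`. [folklore] -/
theorem mem_betaFI (u : ℚ) : FI.mem (r.beta u) (r.betaFI u) :=
  FI.mem_neg (FI.mem_mul (FI.mem_ofRat r.A) (FI.mem_cosSin (r.theta_mem_thetaFI u)).2)

/-- The checks of one ripple at the left end point `u`: `0 ≤ xlo`, and the claimed enclosures contain the engine's. [folklore] -/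
def check (u : ℚ) : Bool :=
  decide (0 ≤ r.xlo) && decide (r.xlo ≤ r.freqFI.loQ) && decide (r.freqFI.hiQ ≤ r.xhi) &&
    decide (r.alo ≤ (r.alphaFI u).loQ) && decide ((r.alphaFI u).hiQ ≤ r.ahi) &&
    decide (r.blo ≤ (r.betaFI u).loQ) && decide ((r.betaFI u).hiQ ≤ r.bhi)

variable {r}

/-- What `check` certifies about the real numbers `x, α, β`. [folklore] -/
theorem check_sound {u : ℚ} (h : r.check u = true) :
    (0 : ℝ) ≤ r.xlo ∧ (r.xlo : ℝ) ≤ r.freq ∧ r.freq ≤ (r.xhi : ℝ) ∧ (r.alo : ℝ) ≤ r.alpha u ∧ r.alpha u ≤ (r.ahi : ℝ) ∧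
      (r.blo : ℝ) ≤ r.beta u ∧ r.beta u ≤ (r.bhi : ℝ) := by
  unfold check at h
  simp only [Bool.and_eq_true, decide_eq_true_eq] at h
  obtain ⟨⟨⟨⟨⟨⟨h0, h1⟩, h2⟩, h3⟩, h4⟩, h5⟩, h6⟩ := h
  refine ⟨by exact_mod_cast h0, ?_, ?_, ?_, ?_, ?_, ?_⟩
  · exact le_trans (by exact_mod_cast h1) (FI.loQ_le r.freq_mem_freqFI)
  · exact le_trans (FI.le_hiQ r.freq_mem_freqFI) (by exact_mod_cast h2)
  · exact le_trans (by exact_mod_cast h3) (FI.loQ_le (r.mem_alphaFI u))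
  · exact le_trans (FI.le_hiQ (r.mem_alphaFI u)) (by exact_mod_cast h4)
  · exact le_trans (by exact_mod_cast h5) (FI.loQ_le (r.mem_betaFI u))
  · exact le_trans (FI.le_hiQ (r.mem_betaFI u)) (by exact_mod_cast h6)

variable (r)

/-- The real Taylor coefficient of order `i` (without `h^i`): `(α Re(I^i) + β Im(I^i)) x^i / i!`. [folklore] -/
def termReal (u : ℚ) (i : ℕ) : ℝ :=
  (r.alpha u * ((reIpowQ i : ℚ) : ℝ) + r.beta u * ((imIpowQ i : ℚ) : ℝ)) * r.freq ^ i / i.factorial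

/-- Enclosure of the signed factor `α Re(I^i) + β Im(I^i)` (exactly one of the two is live). [folklore] -/
def gLo (i : ℕ) : ℚ := min (r.alo * reIpowQ i + r.blo * imIpowQ i) (r.ahi * reIpowQ i + r.bhi * imIpowQ i)

/-- Enclosure of the signed factor, upper end. [folklore] -/
def gHi (i : ℕ) : ℚ := max (r.alo * reIpowQ i + r.blo * imIpowQ i) (r.ahi * reIpowQ i + r.bhi * imIpowQ i)

/-- Lower end of the coefficient interval. [folklore] -/
def termLo (i : ℕ) : ℚ := mul4Lo (r.gLo i) (r.gHi i) (r.xlo ^ i) (r.xhi ^ i) / i.factorial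

/-- Upper end of the coefficient interval. [folklore] -/
def termHi (i : ℕ) : ℚ := mul4Hi (r.gLo i) (r.gHi i) (r.xlo ^ i) (r.xhi ^ i) / i.factorial

/-- `Re(I^i)`, `Im(I^i)`: one of them vanishes, the other is `±1`. [folklore] -/
theorem reIm_cases (i : ℕ) :
    (reIpowQ i = 1 ∧ imIpowQ i = 0) ∨ (reIpowQ i = -1 ∧ imIpowQ i = 0) ∨ (reIpowQ i = 0 ∧ imIpowQ i = 1) ∨
      (reIpowQ i = 0 ∧ imIpowQ i = -1) := by
  unfold reIpowQ imIpowQ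
  have : i % 4 = 0 ∨ i % 4 = 1 ∨ i % 4 = 2 ∨ i % 4 = 3 := by omega
  rcases this with h | h | h | h <;> simp [h]

variable {r}

/-- The signed factor lies in `[gLo, gHi]`. [folklore] -/
theorem g_mem {u : ℚ} (h : r.check u = true) (i : ℕ) :
    ((r.gLo i : ℚ) : ℝ) ≤ r.alpha u * ((reIpowQ i : ℚ) : ℝ) + r.beta u * ((imIpowQ i : ℚ) : ℝ) ∧
      r.alpha u * ((reIpowQ i : ℚ) : ℝ) + r.beta u * ((imIpowQ i : ℚ) : ℝ) ≤ ((r.gHi i : ℚ) : ℝ) := by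
  obtain ⟨-, -, -, ha1, ha2, hb1, hb2⟩ := check_sound h
  unfold gLo gHi
  rcases reIm_cases i with ⟨e1, e2⟩ | ⟨e1, e2⟩ | ⟨e1, e2⟩ | ⟨e1, e2⟩ <;>
    · rw [e1, e2]; push_cast
      constructor
      · refine (min_le_iff).2 ?_
        first
        | exact Or.inl (by nlinarith)
        | exact Or.inr (by nlinarith)
      · refine (le_max_iff).2 ?_
        first
        | exact Or.inr (by nlinarith)
        | exact Or.inl (by nlinarith)

/-- **Coefficient enclosure.** `termLo i ≤ termReal u i ≤ termHi i`. [folklore] -/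
theorem term_mem {u : ℚ} (h : r.check u = true) (i : ℕ) :
    ((r.termLo i : ℚ) : ℝ) ≤ r.termReal u i ∧ r.termReal u i ≤ ((r.termHi i : ℚ) : ℝ) := by
  obtain ⟨hx0, hx1, hx2, -, -, -, -⟩ := check_sound h
  have hg := g_mem h i
  have hp1 : ((r.xlo ^ i : ℚ) : ℝ) ≤ r.freq ^ i := by push_cast; exact pow_le_pow_left₀ hx0 hx1 i
  have hp2 : r.freq ^ i ≤ ((r.xhi ^ i : ℚ) : ℝ) := by push_cast; exact pow_le_pow_left₀ (hx0.trans hx1) hx2 i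
  have hm := mul4_mem hg.1 hg.2 hp1 hp2
  have hf : (0 : ℝ) < (i.factorial : ℝ) := by positivity
  unfold termLo termHi termReal
  push_cast
  constructor
  · rw [div_le_div_iff_of_pos_right hf]; exact_mod_cast hm.1
  · rw [div_le_div_iff_of_pos_right hf]; exact_mod_cast hm.2

/-- `|α| + |β| ≤ max(|alo|,|ahi|) + max(|blo|,|bhi|)`. [folklore] -/
def absAB (r : XRip) : ℚ := max |r.alo| |r.ahi| + max |r.blo| |r.bhi|

/-- The remainder bound of the ripple on a cell of width `w`: `2(|α|+|β|)(xhi·w)^n/n!` majorised. [folklore] -/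
def remB (r : XRip) (w : ℚ) (n : ℕ) : ℚ := 2 * r.absAB * (r.xhi * w) ^ n / n.factorial

/-- **One-ripple Taylor expansion with wide remainder.** For `0 ≤ h ≤ w` with `xhi·w·2 ≤ n+1`:
`|A cos(x(u+h)) − Σ_{i<n} termReal(i) h^i| ≤ remB w n`. [folklore] -/
theorem abs_val_sub_sum_le {u w : ℚ} {n : ℕ} (h : r.check u = true) (hwn : r.xhi * w * 2 ≤ (n : ℚ) + 1)
    {hh : ℝ} (hh0 : 0 ≤ hh) (hhw : hh ≤ (w : ℝ)) :
    |r.val ((u : ℝ) + hh) - ∑ i ∈ Finset.range n, r.termReal u i * hh ^ i| ≤ ((r.remB w n : ℚ) : ℝ) := by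
  obtain ⟨hx0, hx1, hx2, ha1, ha2, hb1, hb2⟩ := check_sound h
  set x : ℝ := r.freq with hxdef
  have hxnn : 0 ≤ x := hx0.trans hx1
  set y : ℝ := hh * x with hydef
  have hy0 : 0 ≤ y := mul_nonneg hh0 hxnn
  have hyle : y ≤ (r.xhi : ℝ) * w := by
    rw [hydef, mul_comm]; exact mul_le_mul hx2 hhw hh0 (hxnn.trans hx2)
  have hw0 : (0 : ℝ) ≤ w := hh0.trans hhw
  have hyn : |y| / (n + 1) ≤ 1 / 2 := by
    rw [abs_of_nonneg hy0, div_le_iff₀ (by positivity)]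
    have : (r.xhi : ℝ) * w * 2 ≤ n + 1 := by exact_mod_cast hwn
    linarith
  have hc := abs_cos_sub_sum_le_wide hyn
  have hs := abs_sin_sub_sum_le_wide hyn
  -- addition formula
  have hadd : r.val ((u : ℝ) + hh) = r.alpha u * Real.cos y + r.beta u * Real.sin y := by
    unfold val alpha beta
    have : ((u : ℝ) + hh) * r.freq = (u : ℝ) * r.freq + y := by rw [hydef, hxdef]; ring
    rw [this, Real.cos_add]; ring
  -- the sum splits the same way
  have hsum : ∑ i ∈ Finset.range n, r.termReal u i * hh ^ i =
      r.alpha u * ∑ i ∈ Finset.range n, ((reIpowQ i : ℚ) : ℝ) * y ^ i / i.factorial +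
        r.beta u * ∑ i ∈ Finset.range n, ((imIpowQ i : ℚ) : ℝ) * y ^ i / i.factorial := by
    rw [Finset.mul_sum, Finset.mul_sum, ← Finset.sum_add_distrib]
    refine Finset.sum_congr rfl fun i _ ↦ ?_
    unfold termReal
    rw [hydef, mul_pow, ← hxdef]
    ring
  rw [hadd, hsum]
  have e : r.alpha u * Real.cos y + r.beta u * Real.sin y -
      (r.alpha u * ∑ i ∈ Finset.range n, ((reIpowQ i : ℚ) : ℝ) * y ^ i / i.factorial +
        r.beta u * ∑ i ∈ Finset.range n, ((imIpowQ i : ℚ) : ℝ) * y ^ i / i.factorial) =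
      r.alpha u * (Real.cos y - ∑ i ∈ Finset.range n, ((reIpowQ i : ℚ) : ℝ) * y ^ i / i.factorial) +
        r.beta u * (Real.sin y - ∑ i ∈ Finset.range n, ((imIpowQ i : ℚ) : ℝ) * y ^ i / i.factorial) := by ring
  rw [e]
  have hA : |r.alpha u| ≤ ((max |r.alo| |r.ahi| : ℚ) : ℝ) := by
    push_cast; rw [abs_le]; constructor
    · have : -(max |(r.alo : ℝ)| |(r.ahi : ℝ)|) ≤ (r.alo : ℝ) := by linarith [neg_abs_le (r.alo : ℝ), le_max_left |(r.alo:ℝ)| |(r.ahi:ℝ)|]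
      linarith
    · linarith [le_abs_self (r.ahi : ℝ), le_max_right |(r.alo:ℝ)| |(r.ahi:ℝ)|]
  have hB : |r.beta u| ≤ ((max |r.blo| |r.bhi| : ℚ) : ℝ) := by
    push_cast; rw [abs_le]; constructor
    · have : -(max |(r.blo : ℝ)| |(r.bhi : ℝ)|) ≤ (r.blo : ℝ) := by linarith [neg_abs_le (r.blo : ℝ), le_max_left |(r.blo:ℝ)| |(r.bhi:ℝ)|]
      linarith
    · linarith [le_abs_self (r.bhi : ℝ), le_max_right |(r.blo:ℝ)| |(r.bhi:ℝ)|]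
  have hyn' : |y| ^ n ≤ ((r.xhi : ℝ) * w) ^ n := by rw [abs_of_nonneg hy0]; exact pow_le_pow_left₀ hy0 hyle n
  have hR : 2 * |y| ^ n / n.factorial ≤ 2 * ((r.xhi : ℝ) * w) ^ n / n.factorial := by
    have hf : (0:ℝ) < n.factorial := by positivity
    rw [div_le_div_iff_of_pos_right hf]; linarith
  have h1 := abs_mul (r.alpha u) (Real.cos y - ∑ i ∈ Finset.range n, ((reIpowQ i : ℚ) : ℝ) * y ^ i / i.factorial)
  have h2 := abs_mul (r.beta u) (Real.sin y - ∑ i ∈ Finset.range n, ((imIpowQ i : ℚ) : ℝ) * y ^ i / i.factorial)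
  have hmA := mul_le_mul hA (hc.trans hR) (abs_nonneg _) (le_trans (abs_nonneg _) hA)
  have hmB := mul_le_mul hB (hs.trans hR) (abs_nonneg _) (le_trans (abs_nonneg _) hB)
  refine (abs_add_le _ _).trans ?_
  rw [h1, h2]
  refine (add_le_add hmA hmB).trans (le_of_eq ?_)
  unfold remB absAB
  push_cast
  ring

/-- `0 ≤ remB w n` for `0 ≤ xhi`, `0 ≤ w`. [folklore] -/
theorem remB_nonneg (r : XRip) {w : ℚ} (hw : 0 ≤ w) (hx : 0 ≤ r.xhi) (n : ℕ) : 0 ≤ r.remB w n := by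
  unfold remB absAB
  have h1 : 0 ≤ max |r.alo| |r.ahi| := le_trans (abs_nonneg _) (le_max_left _ _)
  have h2 : 0 ≤ max |r.blo| |r.bhi| := le_trans (abs_nonneg _) (le_max_left _ _)
  exact div_nonneg (mul_nonneg (mul_nonneg (by norm_num) (add_nonneg h1 h2)) (pow_nonneg (mul_nonneg hx hw) n))
    (by positivity)

end XRip

end Summit.RiemannHypothesis.RiemannHypothesis.Theorems.EvenWinsBeyondArch

end
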